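import Literature.NumberTheory.LFunctions.HeckeThetaInversion
import HarnessLib

/-!
# Hecke's weighted theta functions: the normalised series `Θ̃`, its functional equation, and the
decay of `Θ̃ - Θ̃(∞)`

Topic `Literature/NumberTheory/LFunctions`; namespace `Literature.NumberTheory.LFunctions.NumberField`
(continuing `HeckeThetaInversion.lean`).  Second analytic input (after the transformation formula)
of the continuation of the partial zeta functions of narrow ray classes, following Neukirch,
*Algebraic Number Theory*, VII §8 (8.2)–(8.4) (there for Größencharaktere and ideal numbers; here
for the cosets `a₀ + 𝔞` and the sign weights `N(x^p)`, `p ⊆` real places, cf. VII §8 Remark 1).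

For the Mellin transform it is convenient to absorb the factor `N(y^{p/2}) = ∏_{τ∈p} y_τ^{1/2}`
of Neukirch's kernel `N(y^{(s𝟏+p)/2})` ((8.3): `L_∞(χ,s) = L_X(s𝟏 + p)`) into the theta function.
We therefore set

* `heckeThetaW K p 𝔞 a₀ y = Σ_{a∈𝔞} N((a+a₀)^p) N(y^{p/2}) e^{-π⟨(a+a₀)y, a+a₀⟩}
     (= N(y^{p/2}) · heckeTheta K p 𝔞 a₀ y)`,
* `heckeThetaDualW K p 𝔟 a₀ y = Σ_{b∈𝔟} e^{2πi Tr(a₀b)} N(b^p) N(y^{p/2}) e^{-π⟨by, b⟩}`,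

for which the transformation formula `heckeTheta_eq_heckeThetaDual` takes the same shape as for
`θ_𝔞` (`thetaIdeal_inv`): PROVED

  `heckeThetaW K p 𝔞 a₀ y⁻¹ = (-i)^{|p|} N(y)^{1/2} (𝔑(𝔞) √|d_K|)⁻¹ · heckeThetaDualW K p (𝔞𝔡)⁻¹ a₀ y`
  (`heckeThetaW_inv`),

and we PROVE the bounds feeding the Mellin principle (Neukirch VII (8.4),
`f_F(𝔎,χ,t) = a₀ + O(e^{-ct^{1/n}})`, in polynomial form): with the constant terms
`Θ̃(∞) = 𝟙[p = ∅ ∧ a₀ ∈ 𝔞]` (the term `a + a₀ = 0`) and `Θ̂̃(∞) = 𝟙[p = ∅]` (the term `b = 0`),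

  `‖heckeThetaW K p 𝔞 a₀ y - Θ̃(∞)‖, ‖heckeThetaDualW K p 𝔞 a₀ y - Θ̂̃(∞)‖ ≤ θ_{𝔞+(a₀)}(iy/2) - 1 ≤ C δ^{-k}`

for `y ≥ δ > 0` and `2k > n` (`norm_heckeThetaW_sub_const_le`, `norm_heckeThetaDualW_sub_const_le`,
`weightedThetaTail_le_thetaIdeal_sub_one`, `exists_weightedThetaTail_le`: each factor satisfies
`|x_τ| y_τ^{1/2} e^{-πx_τ²y_τ/2} ≤ 1`, so the general term is bounded by `e^{-π⟨x(y/2),x⟩}`, and the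
decay `thetaIdeal_sub_one_le` of `DedekindZetaTheta.lean` applies to the fractional ideal
`𝔞 + (a₀) ⊇ a₀ + 𝔞`).

## References

* J. Neukirch, *Algebraic Number Theory*, Grundlehren 322, Springer 1999, Ch. VII §3 (3.5)–(3.6),
  §8 (8.2)–(8.4) and Remark 1. [NeukirchANT1999]
* E. Hecke, *Eine neue Art von Zetafunktionen und ihre Beziehungen zur Verteilung der Primzahlen
  II*, Math. Z. 6 (1920), 11–51. [HeckeMathZ1920]
-/

noncomputable section

open MeasureTheory Filter Set Submodule Complex NumberField NumberField.InfinitePlace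
  NumberField.mixedEmbedding
open scoped Real Topology FourierTransform ENNReal NumberField nonZeroDivisors ComplexConjugate

namespace Literature.NumberTheory.LFunctions

namespace NumberField

variable (K : Type*) [Field K] [NumberField K]

open scoped Classical

/-! ## The weighted summand `|N(x^p)| N(y^{p/2}) e^{-π⟨xy,x⟩}` and its Gaussian bound -/

/-- The **weighted theta summand** `|N(x^p)| N(y^{p/2}) e^{-π⟨xy,x⟩} = ∏_{τ∈p} |x_τ| y_τ^{1/2} · e^{-π⟨xy,x⟩}`
(the absolute value of the general term of `Θ̃^p`). [folklore] -/
def weightedThetaSummand (p : Finset {w : InfinitePlace K // IsReal w}) (y : InfinitePlace K → ℝ)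
    (x : K) : ℝ :=
  (∏ w ∈ p, |(mixedEmbedding K x).1 w| * Real.sqrt (y w.1)) * thetaSummand K y x

variable {K}

/-- The weighted summand is nonnegative. [folklore] -/
theorem weightedThetaSummand_nonneg (p : Finset {w : InfinitePlace K // IsReal w})
    (y : InfinitePlace K → ℝ) (x : K) : 0 ≤ weightedThetaSummand K p y x :=
  mul_nonneg (Finset.prod_nonneg fun _ _ ↦ mul_nonneg (abs_nonneg _) (Real.sqrt_nonneg _))
    (thetaSummand_pos y x).le

/-- The weighted summand is the absolute value of the general term `N(x^p) N(y^{p/2}) e^{-π⟨xy,x⟩}`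
of `Θ̃^p`. [folklore] -/
theorem abs_realPow_mul_prod_sqrt_mul (p : Finset {w : InfinitePlace K // IsReal w})
    (y : InfinitePlace K → ℝ) (x : K) :
    |realPow K p x * (∏ w ∈ p, Real.sqrt (y w.1)) * thetaSummand K y x| =
      weightedThetaSummand K p y x := by
  rw [weightedThetaSummand, abs_mul, abs_mul, abs_of_pos (thetaSummand_pos y x), realPow,
    Finset.abs_prod, abs_of_nonneg (Finset.prod_nonneg fun w _ ↦ Real.sqrt_nonneg _),
    ← Finset.prod_mul_distrib]

/-- At `x = 0` the weighted summand is `𝟙[p = ∅]`. [folklore] -/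
theorem weightedThetaSummand_zero (p : Finset {w : InfinitePlace K // IsReal w})
    (y : InfinitePlace K → ℝ) : weightedThetaSummand K p y 0 = if p = ∅ then 1 else 0 := by
  rw [weightedThetaSummand, thetaSummand_zero, mul_one, map_zero]
  split_ifs with hp
  · rw [hp, Finset.prod_empty]
  · obtain ⟨w, hw⟩ := Finset.nonempty_iff_ne_empty.mpr hp
    exact Finset.prod_eq_zero hw (by simp)

/-- `u e^{-u²π/2} ≤ 1` (from `e^z ≥ 1 + z` and `1 + πu²/2 ≥ u`). [folklore] -/
theorem mul_exp_neg_pi_mul_sq_div_two_le_one (u : ℝ) :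
    u * Real.exp (-(π * u ^ 2 / 2)) ≤ 1 := by
  rw [Real.exp_neg, ← div_eq_mul_inv, div_le_one (Real.exp_pos _)]
  have h1 : 1 + π * u ^ 2 / 2 ≤ Real.exp (π * u ^ 2 / 2) := by
    linarith [Real.add_one_le_exp (π * u ^ 2 / 2)]
  have h2 : u ≤ 1 + π * u ^ 2 / 2 := by
    nlinarith [Real.pi_gt_three, sq_nonneg (u - 1)]
  linarith

/-- `|x| y^{1/2} ≤ e^{π y x²/2}` for `y ≥ 0`. [folklore] -/
theorem abs_mul_sqrt_le_exp {x y : ℝ} (hy : 0 ≤ y) :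
    |x| * Real.sqrt y ≤ Real.exp (π * (y * x ^ 2) / 2) := by
  have h := mul_exp_neg_pi_mul_sq_div_two_le_one (|x| * Real.sqrt y)
  have hsq : (|x| * Real.sqrt y) ^ 2 = y * x ^ 2 := by
    rw [mul_pow, sq_abs, Real.sq_sqrt hy]; ring
  rw [hsq, Real.exp_neg, ← div_eq_mul_inv, div_le_one (Real.exp_pos _)] at h
  exact h

/-- The part of `⟨xy, x⟩` at the real places of `p` is at most `⟨xy, x⟩` (all terms are
nonnegative for `y ≥ 0`; `e_τ = 1` and `|x|_τ² = x_τ²` at real `τ`). [folklore] -/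
theorem sum_real_le_minkowskiQuadForm (p : Finset {w : InfinitePlace K // IsReal w})
    {y : InfinitePlace K → ℝ} (hy : ∀ w, 0 ≤ y w) (x : K) :
    ∑ w ∈ p, y w.1 * ((mixedEmbedding K x).1 w) ^ 2 ≤ minkowskiQuadForm K y x := by
  have h1 : ∑ w ∈ p, y w.1 * ((mixedEmbedding K x).1 w) ^ 2 =
      ∑ w ∈ p.map (Function.Embedding.subtype _), (mult w : ℝ) * y w * (w x) ^ 2 := by
    rw [Finset.sum_map]
    refine Finset.sum_congr rfl fun w _ ↦ ?_
    rw [Function.Embedding.coe_subtype, mult_isReal w, Nat.cast_one, one_mul,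
      mixedEmbedding_apply_isReal, ← norm_embedding_of_isReal w.2 x, Real.norm_eq_abs, sq_abs]
  rw [h1, minkowskiQuadForm]
  exact Finset.sum_le_sum_of_subset_of_nonneg (Finset.subset_univ _) fun w _ _ ↦ by
    have := hy w; positivity

/-- Halving `y` halves `⟨xy, x⟩`. [folklore] -/
theorem minkowskiQuadForm_half (y : InfinitePlace K → ℝ) (x : K) :
    minkowskiQuadForm K (fun w ↦ y w / 2) x = minkowskiQuadForm K y x / 2 := by
  rw [minkowskiQuadForm, minkowskiQuadForm, Finset.sum_div]
  exact Finset.sum_congr rfl fun w _ ↦ by ring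

/-- **Gaussian bound for the weighted summand**: `|N(x^p)| N(y^{p/2}) e^{-π⟨xy,x⟩} ≤ e^{-π⟨x(y/2),x⟩}`
for `y ≥ 0` (each factor `|x_τ| y_τ^{1/2} ≤ e^{π y_τ x_τ²/2}`, and `∑_{τ∈p} y_τ x_τ² ≤ ⟨xy,x⟩`).
[folklore] -/
theorem weightedThetaSummand_le (p : Finset {w : InfinitePlace K // IsReal w})
    {y : InfinitePlace K → ℝ} (hy : ∀ w, 0 ≤ y w) (x : K) :
    weightedThetaSummand K p y x ≤ thetaSummand K (fun w ↦ y w / 2) x := by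
  have hprod : ∏ w ∈ p, |(mixedEmbedding K x).1 w| * Real.sqrt (y w.1) ≤
      Real.exp (π * minkowskiQuadForm K y x / 2) := by
    calc ∏ w ∈ p, |(mixedEmbedding K x).1 w| * Real.sqrt (y w.1)
        ≤ ∏ w ∈ p, Real.exp (π * (y w.1 * ((mixedEmbedding K x).1 w) ^ 2) / 2) :=
          Finset.prod_le_prod (fun w _ ↦ mul_nonneg (abs_nonneg _) (Real.sqrt_nonneg _))
            fun w _ ↦ abs_mul_sqrt_le_exp (hy w.1)
      _ = Real.exp (π * (∑ w ∈ p, y w.1 * ((mixedEmbedding K x).1 w) ^ 2) / 2) := by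
          rw [← Real.exp_sum, Finset.mul_sum, Finset.sum_div]
      _ ≤ Real.exp (π * minkowskiQuadForm K y x / 2) := by
          gcongr
          exact sum_real_le_minkowskiQuadForm p hy x
  calc weightedThetaSummand K p y x
      ≤ Real.exp (π * minkowskiQuadForm K y x / 2) * thetaSummand K y x :=
        mul_le_mul_of_nonneg_right hprod (thetaSummand_pos y x).le
    _ = thetaSummand K (fun w ↦ y w / 2) x := by
        rw [thetaSummand, thetaSummand, minkowskiQuadForm_half, ← Real.exp_add]
        congr 1
        ring

/-! ## The absolute tail `Σ_{x ∈ a₀+𝔞, x ≠ 0} |N(x^p)| N(y^{p/2}) e^{-π⟨xy,x⟩}` and its decay -/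

variable (K) in
/-- The **absolute tail** of the weighted theta series of the coset `a₀ + 𝔞`: the sum of the
absolute values of its terms off `x = a + a₀ = 0`. [folklore] -/
def weightedThetaTail (p : Finset {w : InfinitePlace K // IsReal w}) (I : FractionalIdeal (𝓞 K)⁰ K)
    (a₀ : K) (y : InfinitePlace K → ℝ) : ℝ :=
  ∑' a : I, if (a : K) + a₀ = 0 then 0 else weightedThetaSummand K p y ((a : K) + a₀)

/-- The fractional ideal `𝔞 + (a₀)` contains the coset `a₀ + 𝔞`. [folklore] -/
theorem add_mem_sup_spanSingleton (I : FractionalIdeal (𝓞 K)⁰ K) (a₀ : K) (a : I) :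
    (a : K) + a₀ ∈ I ⊔ FractionalIdeal.spanSingleton (𝓞 K)⁰ a₀ := by
  rw [← FractionalIdeal.mem_coe, FractionalIdeal.coe_sup]
  exact Submodule.add_mem_sup a.2 (FractionalIdeal.mem_spanSingleton_self _ a₀)

/-- The terms of the absolute tail are dominated by the terms off `0` of the theta series of
`𝔞 + (a₀)` at `y/2`, along the injection `a ↦ a + a₀`. [folklore] -/
theorem summable_weightedThetaTail (p : Finset {w : InfinitePlace K // IsReal w})
    (I : FractionalIdeal (𝓞 K)⁰ K) (a₀ : K) {y : InfinitePlace K → ℝ} (hy : ∀ w, 0 < y w) :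
    Summable fun a : I ↦ if (a : K) + a₀ = 0 then 0 else weightedThetaSummand K p y ((a : K) + a₀) := by
  have hs := summable_thetaIdeal_holds K I (fun w ↦ y w / 2) fun w ↦ half_pos (hy w)
  -- compare with the theta series of `I` itself shifted: use the bound by `thetaSummand (y/2) (a+a₀)`
  -- and the summability of `a ↦ thetaSummand (y/2) (a + a₀)` via the ideal `I ⊔ (a₀)`.
  set J := I ⊔ FractionalIdeal.spanSingleton (𝓞 K)⁰ a₀ with hJ
  have hsJ := summable_thetaIdeal_holds K J (fun w ↦ y w / 2) fun w ↦ half_pos (hy w)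
  let e : I → J := fun a ↦ ⟨(a : K) + a₀, add_mem_sup_spanSingleton I a₀ a⟩
  have he : Function.Injective e := fun a b h ↦ by
    have := congrArg (fun z : J ↦ (z : K)) h
    exact Subtype.ext (add_right_cancel this)
  refine (hsJ.comp_injective he).of_nonneg_of_le (fun a ↦ ?_) fun a ↦ ?_
  · split_ifs
    · exact le_rfl
    · exact weightedThetaSummand_nonneg p y _
  · simp only [Function.comp_apply]
    split_ifs
    · exact (thetaSummand_pos _ _).le
    · exact weightedThetaSummand_le p (fun w ↦ (hy w).le) _

/-- The absolute tail is nonnegative. [folklore] -/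
theorem weightedThetaTail_nonneg (p : Finset {w : InfinitePlace K // IsReal w})
    (I : FractionalIdeal (𝓞 K)⁰ K) (a₀ : K) (y : InfinitePlace K → ℝ) :
    0 ≤ weightedThetaTail K p I a₀ y :=
  tsum_nonneg fun a ↦ by
    split_ifs
    · exact le_rfl
    · exact weightedThetaSummand_nonneg p y _

/-- **The absolute tail is at most `θ_{𝔞+(a₀)}(iy/2) - 1`** (termwise Gaussian bound
`weightedThetaSummand_le` and the injection `a ↦ a + a₀` of the coset `a₀ + 𝔞` minus `0` into
`(𝔞 + (a₀)) ∖ 0`). [folklore] -/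
theorem weightedThetaTail_le_thetaIdeal_sub_one (p : Finset {w : InfinitePlace K // IsReal w})
    (I : FractionalIdeal (𝓞 K)⁰ K) (a₀ : K) {y : InfinitePlace K → ℝ} (hy : ∀ w, 0 < y w) :
    weightedThetaTail K p I a₀ y ≤
      thetaIdeal K (I ⊔ FractionalIdeal.spanSingleton (𝓞 K)⁰ a₀) (fun w ↦ y w / 2) - 1 := by
  set J := I ⊔ FractionalIdeal.spanSingleton (𝓞 K)⁰ a₀ with hJ
  have hy2 : ∀ w, 0 < y w / 2 := fun w ↦ half_pos (hy w)
  have hsJ := summable_thetaIdeal_holds K J (fun w ↦ y w / 2) hy2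
  -- `θ_J(iy/2) - 1` is the sum of the terms off `0`
  have hsplit : thetaIdeal K J (fun w ↦ y w / 2) - 1 =
      ∑' x : J, if (x : K) = 0 then 0 else thetaSummand K (fun w ↦ y w / 2) (x : K) := by
    rw [thetaIdeal, hsJ.tsum_eq_add_tsum_ite ⟨0, FractionalIdeal.zero_mem J⟩]
    have h0 : ((⟨0, FractionalIdeal.zero_mem J⟩ : J) : K) = 0 := rfl
    rw [h0, thetaSummand_zero, add_sub_cancel_left]
    refine tsum_congr fun x ↦ ?_
    by_cases hx : (x : K) = 0
    · have : x = ⟨0, FractionalIdeal.zero_mem J⟩ := Subtype.ext hx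
      rw [if_pos hx, if_pos this]
    · rw [if_neg hx, if_neg (fun h ↦ hx (congrArg (fun z : J ↦ (z : K)) h))]
  rw [hsplit, weightedThetaTail]
  let e : I → J := fun a ↦ ⟨(a : K) + a₀, add_mem_sup_spanSingleton I a₀ a⟩
  have he : Function.Injective e := fun a b h ↦ by
    have := congrArg (fun z : J ↦ (z : K)) h
    exact Subtype.ext (add_right_cancel this)
  have hsJ' : Summable fun x : J ↦ if (x : K) = 0 then 0 else thetaSummand K (fun w ↦ y w / 2) (x : K) :=
    hsJ.of_nonneg_of_le (fun x ↦ by split_ifs <;> [exact le_rfl; exact (thetaSummand_pos _ _).le])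
      fun x ↦ by split_ifs <;> [exact (thetaSummand_pos _ _).le; exact le_rfl]
  refine Summable.tsum_le_tsum_of_inj e he (fun x _ ↦ ?_) (fun a ↦ ?_)
    (summable_weightedThetaTail p I a₀ hy) hsJ'
  · split_ifs <;> [exact le_rfl; exact (thetaSummand_pos _ _).le]
  · change (if (a : K) + a₀ = 0 then (0 : ℝ) else weightedThetaSummand K p y ((a : K) + a₀)) ≤
      if (a : K) + a₀ = 0 then 0 else thetaSummand K (fun w ↦ y w / 2) ((a : K) + a₀)
    split_ifs
    · exact le_rfl
    · exact weightedThetaSummand_le p (fun w ↦ (hy w).le) _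

/-- **Decay of the absolute tail**: for `2k > n` there is `C` with
`weightedThetaTail K p 𝔞 a₀ y ≤ C δ^{-k}` whenever `y ≥ δ > 0` (from `thetaIdeal_sub_one_le` for
`𝔞 + (a₀)` at `y/2 ≥ δ/2`; polynomial form of Neukirch VII (8.4), `f(t) = a₀ + O(e^{-ct^{1/n}})`).
[cite: NeukirchANT1999, Ch. VII §8 (8.4) Proposition] -/
theorem exists_weightedThetaTail_le (p : Finset {w : InfinitePlace K // IsReal w})
    (I : FractionalIdeal (𝓞 K)⁰ K) (hI : I ≠ 0) (a₀ : K) {k : ℕ} (hk : Module.finrank ℚ K < 2 * k) :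
    ∃ C : ℝ, ∀ (δ : ℝ) (_ : 0 < δ) (y : InfinitePlace K → ℝ) (_ : ∀ w, δ ≤ y w),
      weightedThetaTail K p I a₀ y ≤ C * δ⁻¹ ^ k := by
  set J := I ⊔ FractionalIdeal.spanSingleton (𝓞 K)⁰ a₀ with hJ
  have hJ0 : J ≠ 0 := by
    intro h
    apply hI
    have hle : I ≤ J := le_sup_left
    rw [h, ← FractionalIdeal.bot_eq_zero, le_bot_iff, FractionalIdeal.bot_eq_zero] at hle
    exact hle
  obtain ⟨C, hC⟩ := thetaIdeal_sub_one_le K J hJ0 hk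
  refine ⟨C * 2 ^ k, fun δ hδ y hy ↦ ?_⟩
  have hy0 : ∀ w, 0 < y w := fun w ↦ hδ.trans_le (hy w)
  calc weightedThetaTail K p I a₀ y
      ≤ thetaIdeal K J (fun w ↦ y w / 2) - 1 := weightedThetaTail_le_thetaIdeal_sub_one p I a₀ hy0
    _ ≤ C * (δ / 2)⁻¹ ^ k := hC (δ / 2) (half_pos hδ) _ fun w ↦ by linarith [hy w]
    _ = C * 2 ^ k * δ⁻¹ ^ k := by rw [inv_div, div_eq_mul_inv, mul_pow]; ring

/-! ## The normalised theta series `Θ̃`, `Θ̂̃` and their constant terms -/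

variable (K)

/-- **The normalised weighted theta series of the coset `a₀ + 𝔞`**:
`Θ̃^p_{𝔞,a₀}(y) = Σ_{a∈𝔞} N((a+a₀)^p) N(y^{p/2}) e^{-π⟨(a+a₀)y, a+a₀⟩}`, i.e. `N(y^{p/2}) θ^p` for
Neukirch's `θ^p_Γ(a₀, 0, iy)` (VII (3.4)); the factor `N(y^{p/2}) = ∏_{τ∈p} y_τ^{1/2}` is the part
`N(x^{p/2})` of the kernel of VII (8.3). [cite: NeukirchANT1999, Ch. VII §3 (3.4) Definition and §8 (8.3)] -/
def heckeThetaW (p : Finset {w : InfinitePlace K // IsReal w}) (I : FractionalIdeal (𝓞 K)⁰ K) (a₀ : K)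
    (y : InfinitePlace K → ℝ) : ℂ :=
  ∑' a : I, ((realPow K p ((a : K) + a₀) * (∏ w ∈ p, Real.sqrt (y w.1)) *
    thetaSummand K y ((a : K) + a₀) : ℝ) : ℂ)

/-- **The normalised dual theta series** `Θ̂̃^p_{𝔟,a₀}(y) = Σ_{b∈𝔟} e^{2πi Tr(a₀b)} N(b^p) N(y^{p/2}) e^{-π⟨by,b⟩}`.
[cite: NeukirchANT1999, Ch. VII §3 (3.4) Definition and (3.6)] -/
def heckeThetaDualW (p : Finset {w : InfinitePlace K // IsReal w}) (I : FractionalIdeal (𝓞 K)⁰ K)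
    (a₀ : K) (y : InfinitePlace K → ℝ) : ℂ :=
  ∑' b : I, (𝐞 (((Algebra.trace ℚ K (a₀ * (b : K)) : ℚ) : ℝ)) : ℂ) *
    ((realPow K p (b : K) * (∏ w ∈ p, Real.sqrt (y w.1)) * thetaSummand K y (b : K) : ℝ) : ℂ)

/-- The **constant term** `Θ̃(∞) = 𝟙[p = ∅ ∧ a₀ ∈ 𝔞]` of `Θ̃^p_{𝔞,a₀}`: the term `a + a₀ = 0`
(present iff `a₀ ∈ 𝔞`, and then `N(0^p) = 𝟙[p = ∅]`); Neukirch's `ε(χ)` of VII §8 / `a₀` of (8.4).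
[cite: NeukirchANT1999, Ch. VII §8 (8.4) Proposition] -/
def heckeThetaConst (p : Finset {w : InfinitePlace K // IsReal w}) (I : FractionalIdeal (𝓞 K)⁰ K)
    (a₀ : K) : ℂ :=
  if p = ∅ ∧ a₀ ∈ I then 1 else 0

variable {K}

/-- `Θ̃ = N(y^{p/2}) · Θ`. [folklore] -/
theorem heckeThetaW_eq (p : Finset {w : InfinitePlace K // IsReal w}) (I : FractionalIdeal (𝓞 K)⁰ K)
    (a₀ : K) (y : InfinitePlace K → ℝ) :
    heckeThetaW K p I a₀ y = ((∏ w ∈ p, Real.sqrt (y w.1) : ℝ) : ℂ) * heckeTheta K p I a₀ y := by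
  rw [heckeThetaW, heckeTheta, ← tsum_mul_left]
  refine tsum_congr fun a ↦ ?_
  push_cast
  ring

/-- `Θ̂̃ = N(y^{p/2}) · Θ̂`. [folklore] -/
theorem heckeThetaDualW_eq (p : Finset {w : InfinitePlace K // IsReal w})
    (I : FractionalIdeal (𝓞 K)⁰ K) (a₀ : K) (y : InfinitePlace K → ℝ) :
    heckeThetaDualW K p I a₀ y =
      ((∏ w ∈ p, Real.sqrt (y w.1) : ℝ) : ℂ) * heckeThetaDual K p I a₀ y := by
  rw [heckeThetaDualW, heckeThetaDual, ← tsum_mul_left]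
  refine tsum_congr fun b ↦ ?_
  push_cast
  ring

/-- **Functional equation of the normalised theta series** (from `heckeTheta_eq_heckeThetaDual`,
Neukirch VII (3.6) with (5.7); the shape is that of `thetaIdeal_inv`, i.e. of the first formula of
VII (5.8)/(8.4), `f(1/t) = W t^{1/2 + Tr(p)/n} g(t)` before integration): for a nonzero fractional
ideal `𝔞`, `a₀ ∈ K`, `p ⊆` real places and `y ∈ R_+^*`,
`Θ̃^p_{𝔞,a₀}(y⁻¹) = (-i)^{|p|} N(y)^{1/2} (𝔑(𝔞) √|d_K|)⁻¹ Θ̂̃^p_{(𝔞𝔡)⁻¹,a₀}(y)`.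
[cite: NeukirchANT1999, Ch. VII §3 (3.6) Theta Transformation Formula, with (5.7) and §8 (8.4)] -/
theorem heckeThetaW_inv (p : Finset {w : InfinitePlace K // IsReal w})
    (I : (FractionalIdeal (𝓞 K)⁰ K)ˣ) (a₀ : K) {y : InfinitePlace K → ℝ} (hy : ∀ w, 0 < y w) :
    heckeThetaW K p I a₀ (fun w ↦ (y w)⁻¹) =
      (-Complex.I) ^ p.card * ((Real.sqrt (mixedNorm K y) /
        ((FractionalIdeal.absNorm (I : FractionalIdeal (𝓞 K)⁰ K) : ℝ) * Real.sqrt |(discr K : ℝ)|) : ℝ) : ℂ) *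
      heckeThetaDualW K p (FractionalIdeal.dual ℤ ℚ (I : FractionalIdeal (𝓞 K)⁰ K)) a₀ y := by
  have hy' : ∀ w, 0 < (y w)⁻¹ := fun w ↦ inv_pos.mpr (hy w)
  have h := heckeTheta_eq_heckeThetaDual p I a₀ hy'
  simp only [inv_inv] at h
  rw [heckeThetaW_eq, heckeThetaDualW_eq, h]
  -- compare the real constants
  have hN : mixedNorm K (fun w ↦ (y w)⁻¹) = (mixedNorm K y)⁻¹ := by
    simp only [mixedNorm, inv_pow, Finset.prod_inv_distrib]
  have hNpos : 0 < mixedNorm K y := Finset.prod_pos fun w _ ↦ pow_pos (hy w) _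
  have hP : ∏ w ∈ p, Real.sqrt ((y w.1)⁻¹) = (∏ w ∈ p, Real.sqrt (y w.1))⁻¹ := by
    rw [← Finset.prod_inv_distrib]
    exact Finset.prod_congr rfl fun w _ ↦ Real.sqrt_inv _
  have hPpos : 0 < ∏ w ∈ p, Real.sqrt (y w.1) := Finset.prod_pos fun w _ ↦ Real.sqrt_pos.mpr (hy w.1)
  have hTpos : 0 < ∏ w ∈ p, y w.1 := Finset.prod_pos fun w _ ↦ hy w.1
  have hT : (∏ w ∈ p, Real.sqrt (y w.1)) * (∏ w ∈ p, Real.sqrt (y w.1)) = ∏ w ∈ p, y w.1 := by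
    rw [← Finset.prod_mul_distrib]
    exact Finset.prod_congr rfl fun w _ ↦ Real.mul_self_sqrt (hy w.1).le
  have hTinv : ∏ w ∈ p, (y w.1)⁻¹ = (∏ w ∈ p, y w.1)⁻¹ := Finset.prod_inv_distrib _
  have hI0 : (0 : ℝ) < (FractionalIdeal.absNorm (I : FractionalIdeal (𝓞 K)⁰ K) : ℝ) := by
    have h0 : FractionalIdeal.absNorm (I : FractionalIdeal (𝓞 K)⁰ K) ≠ 0 := by
      rw [ne_eq, FractionalIdeal.absNorm_eq_zero_iff]; exact I.ne_zero
    have h1 : (0 : ℚ) ≤ FractionalIdeal.absNorm (I : FractionalIdeal (𝓞 K)⁰ K) :=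
      FractionalIdeal.absNorm_nonneg _
    exact_mod_cast lt_of_le_of_ne h1 h0.symm
  have hd : 0 < Real.sqrt |(discr K : ℝ)| :=
    Real.sqrt_pos.mpr (abs_pos.mpr (Int.cast_ne_zero.mpr (discr_ne_zero K)))
  have hsN : 0 < Real.sqrt (mixedNorm K y) := Real.sqrt_pos.mpr hNpos
  rw [hN, hP, hTinv, ← hT, Real.sqrt_inv]
  have h1 : ∏ w ∈ p, ((Real.sqrt (y w.1) : ℝ) : ℂ) ≠ 0 := by
    rw [← Complex.ofReal_prod]; exact_mod_cast hPpos.ne'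
  have h2 : ((Real.sqrt (mixedNorm K y) : ℝ) : ℂ) ≠ 0 := by exact_mod_cast hsN.ne'
  have h3 : ((FractionalIdeal.absNorm (I : FractionalIdeal (𝓞 K)⁰ K) : ℝ) : ℂ) ≠ 0 := by
    exact_mod_cast hI0.ne'
  have h4 : ((Real.sqrt |(discr K : ℝ)| : ℝ) : ℂ) ≠ 0 := by exact_mod_cast hd.ne'
  push_cast
  field_simp

/-! ## Bounds: `‖Θ̃ - Θ̃(∞)‖ ≤ tail`, `‖Θ̂̃ - Θ̂̃(∞)‖ ≤ tail` -/

/-- The terms of `Θ̃^p_{𝔞,a₀}` off `a + a₀ = 0`, and the constant term. [folklore] -/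
theorem heckeThetaW_term_eq (p : Finset {w : InfinitePlace K // IsReal w}) (y : InfinitePlace K → ℝ)
    (x : K) (hx : x = 0) :
    ((realPow K p x * (∏ w ∈ p, Real.sqrt (y w.1)) * thetaSummand K y x : ℝ) : ℂ) =
      if p = ∅ then 1 else 0 := by
  subst hx
  rw [thetaSummand_zero, mul_one, realPow, map_zero]
  split_ifs with hp
  · rw [hp, Finset.prod_empty, Finset.prod_empty]; simp
  · obtain ⟨w, hw⟩ := Finset.nonempty_iff_ne_empty.mpr hp
    rw [Finset.prod_eq_zero hw (by simp)]; simp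

/-- **`‖Θ̃^p_{𝔞,a₀}(y) - Θ̃(∞)‖ ≤ tail`**: the normalised theta series minus its constant term is
bounded by the absolute tail (triangle inequality for the `tsum`). [folklore] -/
theorem norm_heckeThetaW_sub_const_le (p : Finset {w : InfinitePlace K // IsReal w})
    (I : FractionalIdeal (𝓞 K)⁰ K) (a₀ : K) {y : InfinitePlace K → ℝ} (hy : ∀ w, 0 < y w) :
    ‖heckeThetaW K p I a₀ y - heckeThetaConst K p I a₀‖ ≤ weightedThetaTail K p I a₀ y := by
  -- the summable family of terms off the zero term
  set F : I → ℂ := fun a ↦ if (a : K) + a₀ = 0 then 0 else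
    ((realPow K p ((a : K) + a₀) * (∏ w ∈ p, Real.sqrt (y w.1)) *
      thetaSummand K y ((a : K) + a₀) : ℝ) : ℂ) with hF
  have hFnorm : ∀ a, ‖F a‖ = (if (a : K) + a₀ = 0 then 0 else weightedThetaSummand K p y ((a : K) + a₀)) := by
    intro a
    simp only [hF]
    split_ifs
    · exact norm_zero
    · rw [Complex.norm_real, Real.norm_eq_abs, abs_realPow_mul_prod_sqrt_mul]
  have hFs : Summable F :=
    Summable.of_norm (by simpa only [hFnorm] using summable_weightedThetaTail p I a₀ hy)
  -- `Θ̃ - const = ∑ F`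
  have hdiff : heckeThetaW K p I a₀ y - heckeThetaConst K p I a₀ = ∑' a, F a := by
    have hneg : ∀ {x : K}, x ∈ I → -x ∈ I := fun hx ↦
      FractionalIdeal.mem_coe.mp (Submodule.neg_mem _ (FractionalIdeal.mem_coe.mpr hx))
    by_cases ha₀ : a₀ ∈ I
    · -- the zero term is present at `a = -a₀`
      let z : I := ⟨-a₀, hneg ha₀⟩
      have hz : (z : K) + a₀ = 0 := neg_add_cancel a₀
      have hsum : Summable fun a : I ↦ ((realPow K p ((a : K) + a₀) * (∏ w ∈ p, Real.sqrt (y w.1)) *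
          thetaSummand K y ((a : K) + a₀) : ℝ) : ℂ) := by
        refine (hFs.add (summable_of_ne_finset_zero (s := {z}) (f := fun a : I ↦
          if a = z then (if p = ∅ then (1 : ℂ) else 0) else 0) fun a ha ↦ ?_)).congr fun a ↦ ?_
        · rw [Finset.mem_singleton] at ha; rw [if_neg ha]
        · simp only [hF]
          by_cases ha : a = z
          · subst ha; rw [if_pos hz, if_pos rfl, zero_add, heckeThetaW_term_eq p y _ hz]
          · have : (a : K) + a₀ ≠ 0 := fun h ↦ ha (Subtype.ext (by
              change (a : K) = -a₀; exact eq_neg_of_add_eq_zero_left h))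
            rw [if_neg this, if_neg ha, add_zero]
      rw [heckeThetaW, hsum.tsum_eq_add_tsum_ite z, heckeThetaConst, heckeThetaW_term_eq p y _ hz]
      simp only [ha₀, and_true, add_sub_cancel_left]
      refine tsum_congr fun a ↦ ?_
      simp only [hF]
      by_cases ha : a = z
      · subst ha; rw [if_pos rfl, if_pos hz]
      · have : (a : K) + a₀ ≠ 0 := fun h ↦ ha (Subtype.ext (by
          change (a : K) = -a₀; exact eq_neg_of_add_eq_zero_left h))
        rw [if_neg ha, if_neg this]
    · -- no zero term
      have hne : ∀ a : I, (a : K) + a₀ ≠ 0 := fun a h ↦ ha₀ (by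
        have : a₀ = -(a : K) := eq_neg_of_add_eq_zero_right h
        rw [this]; exact hneg a.2)
      rw [heckeThetaConst, if_neg (fun h ↦ ha₀ h.2), sub_zero, heckeThetaW]
      exact tsum_congr fun a ↦ by simp only [hF, if_neg (hne a)]
  rw [hdiff, weightedThetaTail]
  calc ‖∑' a, F a‖ ≤ ∑' a, ‖F a‖ := norm_tsum_le_tsum_norm hFs.norm
    _ = _ := tsum_congr hFnorm

/-- **`‖Θ̂̃^p_{𝔞,a₀}(y) - 𝟙[p = ∅]‖ ≤ tail`** for the dual (character-twisted, unshifted) series: the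
characters have absolute value `1`, so the same absolute tail (with shift `0`) dominates. [folklore] -/
theorem norm_heckeThetaDualW_sub_const_le (p : Finset {w : InfinitePlace K // IsReal w})
    (I : FractionalIdeal (𝓞 K)⁰ K) (a₀ : K) {y : InfinitePlace K → ℝ} (hy : ∀ w, 0 < y w) :
    ‖heckeThetaDualW K p I a₀ y - (if p = ∅ then 1 else 0)‖ ≤ weightedThetaTail K p I 0 y := by
  set F : I → ℂ := fun b ↦ if (b : K) = 0 then 0 else
    (𝐞 (((Algebra.trace ℚ K (a₀ * (b : K)) : ℚ) : ℝ)) : ℂ) *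
      ((realPow K p (b : K) * (∏ w ∈ p, Real.sqrt (y w.1)) * thetaSummand K y (b : K) : ℝ) : ℂ) with hF
  have hFnorm : ∀ b, ‖F b‖ = (if (b : K) + 0 = 0 then 0 else weightedThetaSummand K p y ((b : K) + 0)) := by
    intro b
    simp only [hF, add_zero]
    split_ifs
    · exact norm_zero
    · rw [norm_mul, Circle.norm_coe, one_mul, Complex.norm_real, Real.norm_eq_abs,
        abs_realPow_mul_prod_sqrt_mul]
  have hFs : Summable F :=
    Summable.of_norm (by simpa only [hFnorm] using summable_weightedThetaTail p I 0 hy)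
  let z : I := ⟨0, FractionalIdeal.zero_mem I⟩
  have hz : (z : K) = 0 := rfl
  have hterm0 : (𝐞 (((Algebra.trace ℚ K (a₀ * (z : K)) : ℚ) : ℝ)) : ℂ) *
      ((realPow K p (z : K) * (∏ w ∈ p, Real.sqrt (y w.1)) * thetaSummand K y (z : K) : ℝ) : ℂ) =
        if p = ∅ then 1 else 0 := by
    rw [hz, mul_zero, map_zero, Rat.cast_zero, AddChar.map_zero_eq_one, Circle.coe_one, one_mul]
    exact heckeThetaW_term_eq p y 0 rfl
  have hsum : Summable fun b : I ↦ (𝐞 (((Algebra.trace ℚ K (a₀ * (b : K)) : ℚ) : ℝ)) : ℂ) *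
      ((realPow K p (b : K) * (∏ w ∈ p, Real.sqrt (y w.1)) * thetaSummand K y (b : K) : ℝ) : ℂ) := by
    refine (hFs.add (summable_of_ne_finset_zero (s := {z}) (f := fun b : I ↦
      if b = z then (if p = ∅ then (1 : ℂ) else 0) else 0) fun b hb ↦ ?_)).congr fun b ↦ ?_
    · rw [Finset.mem_singleton] at hb; rw [if_neg hb]
    · simp only [hF]
      by_cases hb : b = z
      · subst hb; rw [if_pos hz, if_pos rfl, zero_add, hterm0]
      · have : (b : K) ≠ 0 := fun h ↦ hb (Subtype.ext h)
        rw [if_neg this, if_neg hb, add_zero]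
  have hdiff : heckeThetaDualW K p I a₀ y - (if p = ∅ then 1 else 0) = ∑' b, F b := by
    rw [heckeThetaDualW, hsum.tsum_eq_add_tsum_ite z, hterm0, add_sub_cancel_left]
    refine tsum_congr fun b ↦ ?_
    simp only [hF]
    by_cases hb : b = z
    · subst hb; rw [if_pos rfl, if_pos hz]
    · have : (b : K) ≠ 0 := fun h ↦ hb (Subtype.ext h)
      rw [if_neg hb, if_neg this]
  rw [hdiff, weightedThetaTail]
  calc ‖∑' b, F b‖ ≤ ∑' b, ‖F b‖ := norm_tsum_le_tsum_norm hFs.norm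
    _ = _ := tsum_congr hFnorm

end NumberField

end Literature.NumberTheory.LFunctions
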